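import Summits.AtomisticToContinuum.BoseEinsteinCondensation.Theses.BECCutLineWeakDisorder

/-!
# Sketch — crux-ideate stmt-AtomisticToContinuum-14978 (`WitnessTransfer`), ideator 1, round 1

First lemmas of the two idea cards, stated over existing declarations (they need not be proved
here; `sorry` allowed in a sketch). Card slugs: `log-convex-partition-transfer`,
`pair-shell-singular-locus`.
-/

noncomputable section

open MeasureTheory Filter Set
open scoped ENNReal NNReal Topology

namespace Summit.AtomisticToContinuum.BoseEinsteinCondensation.Cruxes.WitnessTransfer.IdeatorSketch1

open Literature.MathematicalPhysics.QuantumManyBody.BoseGas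

variable {N : ℕ}

/-! ## Card `log-convex-partition-transfer` -/

/-- **First lemma (B1): midpoint log-convexity of the partition function `Z(T) = ‖e^{-TH_N}g‖₂²`.**
`Z(T+s)² ≤ Z(T) · Z(T+2s)`: by `fkNormSq_eq` and the semigroup law,
`Z(T+s) = ⟨e^{-TH}g, e^{-(T+2s)H}g⟩`, then Cauchy–Schwarz. No spectral theorem. -/
theorem fkNormSq_add_sq_le_mul {v : ℝ → ℝ≥0∞} (hv : Measurable v) (L : ℝ) {T s : ℝ}
    (hT : 0 ≤ T) (hs : 0 ≤ s) {g : Config N → ℝ≥0∞} (hg : Measurable g) :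
    fkNormSq v L (T + s) g ^ 2 ≤ fkNormSq v L T g * fkNormSq v L (T + 2 * s) g := by
  sorry

/-- **(B3) the integrated eigen-INEQUALITY at finite `T`** (consequence of B1 + monotonicity of
`Z`): there is a "slope energy" `E ≥ 0` (the right log-derivative of `Z` at `T`, halved) with
`⟨Ψ_T, e^{-tH}Ψ_T⟩ = Z(T + t/2)/Z(T) ≥ e^{-tE}` for ALL `t ≥ 0` — exactly the shape consumed by the
library's Part II (`eigen_pairing_upper_bound`) with `Ψ₀ := Ψ_T`, `λ := E`. Stated for `g ≡ 1`. -/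
theorem exists_slope_energy {v : ℝ → ℝ≥0∞} (hv : Measurable v) (L : ℝ) {T : ℝ} (hT : 0 < T)
    (hZ : ∀ T' : ℝ, 0 ≤ T' → fkNormSq (N := N) v L T' (fun _ => 1) ≠ 0) :
    ∃ E : ℝ, 0 ≤ E ∧ ∀ t : ℝ, 0 ≤ t →
      ENNReal.ofReal (Real.exp (-(t * E))) * fkNormSq (N := N) v L T (fun _ => 1) ≤
        fkNormSq (N := N) v L (T + t / 2) (fun _ => 1) := by
  sorry

/-- **(B2) decay rate of `Z` is at most the energy of ANY bounded real `C¹` Dirichlet function**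
(positivity of the kernel + the same Cauchy–Schwarz convexity for `j ↦ log ⟨ψ, e^{-jtH}ψ⟩` + the
library's small-time form bound, Part I): for every trial state `Ψ` and `ε > 0`, eventually in `T`,
`Z(T) ≥ e^{-2T(energy Ψ + ε)}` (real nonnegative `Ψ`; finite energy). Hence the slope energies of
(B3) are eventually `≤ groundStateEnergy + ε` — with no ground state, no Perron–Frobenius. -/
theorem fkNormSq_one_ge_exp_energy {v : ℝ → ℝ≥0∞} (hv : Measurable v) (hb : ∃ C : ℝ≥0, ∀ r, v r ≤ C)
    {L : ℝ} (hL : 0 < L) (Ψ : TrialState N L) (hre : ∀ X, Ψ.ψ X = (‖Ψ.ψ X‖ : ℂ))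
    (hE : energy v Ψ ≠ ⊤) {ε : ℝ} (hε : 0 < ε) :
    ∀ᶠ T : ℝ in atTop,
      ENNReal.ofReal (Real.exp (-(2 * T * ((energy v Ψ).toReal + ε)))) ≤
        fkNormSq (N := N) v L T (fun _ => 1) := by
  sorry

/-! ## Card `pair-shell-singular-locus` -/

/-- The (one-dimensional) **singular locus** of a pair potential: radii `r > 0` at which `v` is not
locally integrable (this contains the essential support of `{v = ⊤}`; hard core `[0,a]` ↦ `(0,a]`).
It is a closed subset of `(0, ∞)`. -/
def singularLocus (v : ℝ → ℝ≥0∞) : Set ℝ :=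
  {r | 0 < r ∧ ∀ κ : ℝ, 0 < κ → ∫⁻ t in Set.Ioo (r - κ) (r + κ), v t = ⊤}

/-- **First lemma (T1, trial-state side): the shell cut-off is energy-free for `C¹` states.**
A finite-energy trial state vanishes on every shell `|xᵢ - xⱼ| ∈ singularLocus v` (continuity +
non-integrability), is globally Lipschitz, hence has mass `O(η²·|layer|)` in the `η`-layer around
the shells; multiplying by a smooth symmetric pair cut-off and renormalising costs `o(1)` as
`η → 0` (continuity of Lebesgue measure only — no Hardy, no capacity, no Hedberg). -/
theorem exists_trialState_vanishing_near_shells {v : ℝ → ℝ≥0∞} (hv : IsRepulsiveFiniteRange v)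
    {L : ℝ} (hL : 0 < L) (Ψ : TrialState N L) (hE : energy v Ψ ≠ ⊤)
    (hre : ∀ X, Ψ.ψ X = (‖Ψ.ψ X‖ : ℂ)) {ε : ℝ≥0∞} (hε : 0 < ε) :
    ∃ η : ℝ, 0 < η ∧ ∃ Φ : TrialState N L, energy v Φ ≤ energy v Ψ + ε ∧
      (∀ X, Φ.ψ X = (‖Φ.ψ X‖ : ℂ)) ∧
      ∀ X : Config N, (∃ i j : Fin N, i ≠ j ∧ ∃ r ∈ singularLocus v,
        |dist (X i) (X j) - r| < η) → Φ.ψ X = 0 := by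
  sorry

/-- **First lemma (T2, Feynman–Kac side): one-constraint domination.** The partition function is
bounded by the Wiener probability that ONE chosen pair spends zero time at radii where `v = ⊤`
(dropping the box killing, the other pairs and the finite part of the action only increases the
weight: `fkWeight ≤ 𝟙{Leb{s ≤ T : v(|Bⁱ_s - Bʲ_s|) = ⊤} = 0}` since a positive-measure set of
`⊤`-times makes `pathAction = ⊤`, `expNeg ⊤ = 0`). With the 1-D covering/occupation lemma this
gives the LINEAR vanishing `(e^{-TH}1)(X) ≤ C · dist(|xᵢ-xⱼ|, shell)` at every essential hard
shell, uniformly in `T ≥ 1`. -/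
theorem fkPartition_le_pair_avoids {v : ℝ → ℝ≥0∞} (hv : Measurable v) (L T : ℝ) (X : Config N)
    (i j : Fin N) (hij : i < j) :
    fkPartition v L T X ≤ wienerPaths N {ω | volume {s ∈ Set.Ioc (0 : ℝ) T |
      v (dist (worldLine X ω s.toNNReal i) (worldLine X ω s.toNNReal j)) = ⊤} = 0} := by
  sorry

end Summit.AtomisticToContinuum.BoseEinsteinCondensation.Cruxes.WitnessTransfer.IdeatorSketch1
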